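import Summits.BirchSwinnertonDyer.BirchSwinnertonDyer.Theorems.TameQuarticManinParityModThreeSaturationOfNormImageOfShiftDatum
import Summits.BirchSwinnertonDyer.BirchSwinnertonDyer.Theorems.TameQuarticManinParityNormImageAvoidsThreeOfSerreWeight
import HarnessLib

/-!
# Crux MS `TprimeIrrModThreeSaturation` (stmt-BirchSwinnertonDyer-23367) from TWO named print facts —
# LINE `abelian-fixed-points` closed modulo facts (lead `cruxlead-stmt-BirchSwinnertonDyer-23367` g0)

`tprimeIrrModThreeSaturation_of_facts`: the crux MS follows from
(F₁) `Literature.NumberTheory.EllipticCurves.normImage_modThree_serreWeight_le_four` (irreducible mod-`3` systems in the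
`t`-norm image of `H₁(X₀(N), ℤ)`, `9 ∣ N` — the level-`N/3` part — have Serre weight `≤ 4`: DDT95 Thm. 3.1(f),(g),
Serre 1987 §2) and
(F₂) `Literature.NumberTheory.EllipticCurves.nonempty_shiftDatumEichlerShimuraFixedFrobenius` (the `ℚ`-structure of
`J₀(N)` with shift, Eichler–Shimura on `J₀(N)[3]`, Frobenius at `p ≡ 1 (mod N)` trivial on `π₀(J₀(N)^t)`),
through the landed chain H1 ⇐ F₁ (p677366), E30 ⇐ F₂ (p676604), B30 proved (p675317), H2 ⇐ E30 ∧ B30 (p673875),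
A29 ⇐ H1 ∧ H2 and MS ⇐ A29 (p673284). CONDITIONAL RESULT: the crux is closed MODULO the two facts (no `X₀(N)` over
`ℚ` in Mathlib; both facts are print). No multiplicity one anywhere. No summit is proved; BSD is NOT proved.
-/

set_option autoImplicit false
-- D-0017: single-problem summit, so `Summit.BirchSwinnertonDyer.BirchSwinnertonDyer.…` repeats a namespace BY DESIGN.
set_option linter.dupNamespace false

noncomputable section

namespace Summit.BirchSwinnertonDyer.BirchSwinnertonDyer.Theorems.TameQuarticManinParity

/-- **MS modulo two named facts** (`TprimeIrrModThreeSaturation`, stmt-BirchSwinnertonDyer-23367): conditional closure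
of the crux of LINE `abelian-fixed-points`. [cite: DarmonDiamondTaylor1995, Thm. 1.29 (p. 37) and Thm. 3.1 (f),(g) (p. 86)] -/
theorem tprimeIrrModThreeSaturation_of_facts
    (hF₁ : Literature.NumberTheory.EllipticCurves.normImage_modThree_serreWeight_le_four)
    (hF₂ : Literature.NumberTheory.EllipticCurves.nonempty_shiftDatumEichlerShimuraFixedFrobenius) :
    Theses.TameQuarticManinParity.TprimeIrrModThreeSaturation :=
  tprimeIrrModThreeSaturation_of_normImage_of_shiftDatum (normImageAvoidsThree_of_serreWeightFact hF₁) hF₂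

end Summit.BirchSwinnertonDyer.BirchSwinnertonDyer.Theorems.TameQuarticManinParity

end
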